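import Mathlib
import Summits.ResolutionOfSingularities.ResolutionOfSingularities.Theorems.WeightedInvariantLocalWeightedDropNCBranchPrimesSwap
import Summits.ResolutionOfSingularities.ResolutionOfSingularities.Theorems.WeightedInvariantLocalWeightedDropTOT2CurveSwapShift

/-!
# `LocalWeightedDrop`, TOT2-LINE regime (P), piece (β-prime) — THE READING FOR `u₂`-GRAPH DATA (through the swap) and DISJOINTNESS from the
# `u₁`-graph reading

Crux item stmt-ResolutionOfSingularities-8899 `WeightedInvariant.LocalWeightedDrop` (route `ResolutionOfSingularities/WeightedInvariant`), ENGINE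
skeleton v34 (80c4710965b6845c), registered stub `stub_regimePresented`, piece (P3) (res-type-088's conflict budget sums over u₁-graph data of `A`
AND u₁-graph data of the swapped label `j ↦ A_j(u₂,u₁)` = `u₂`-graphs of `A`; NAMING res-type-088 2026-08-27T16:46:34Z (3)/(4)).  [OURS · L1 W4.3 ·
chain w43 · seat res-L1-w43-stub-1 gen 6; def-free; `…NCBranchPrimesReading` (`exists_prime_of_graphDatum`, `mem_pow_of_inverse`, `exists_inverse_ringHom`)
+ `…NCBranchPrimesSwap` (`subst_extendLast_swap_monicGerm`, `isUnit_det_linMat_swap`); nothing here is a statement of any manuscript; AI-produced,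
gate-checked, weaker than expert review.]

* `subst_extendLast_rename` — the `y`-fixing extension of a plane substitution acts on plane series by the plane substitution;
* **`exists_prime_of_swapGraphDatum`** — a u₁-graph datum `(g, ψ)` of the SWAPPED label gives a prime `P` of `k⟦u₁,u₂,y⟧` with `P ≠ 𝔪`,
  `monicGerm d A ∈ P^d` (the SAME index set as for u₁-graph data), `u₁ − u₂·ĝ ∈ P` (`ĝ = g(u₂)`), `u₂ ∉ P`, and `P` meets the `u₁`-free plane
  series trivially — pulled back along the swap automorphism of `k⟦u₁,u₂,y⟧`;
* `eq_of_sub_mem_of_sub_mem_swap` — injectivity of `g ↦ P`;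
* **`ne_of_readings`** — a prime read from a u₁-graph datum `h` is never a prime read from a TANGENT u₂-graph datum `g` (`g(0) = 0`): the two
  index families are disjoint inside `{P | monicGerm d A ∈ P^d}`.
-/

set_option linter.dupNamespace false -- mandated namespace of this single-conjunct summit

noncomputable section

namespace Summit.ResolutionOfSingularities.ResolutionOfSingularities.Theorems

namespace NCBranchPrimes

open MvPowerSeries PolyDescent MonicDescent WildMonic NCPoly Literature.AlgebraicGeometry.Resolution

variable {k : Type} [Field k]

/-- The `y`-fixing extension `extendLast τ` of a plane substitution `τ` (zero constant terms) acts on plane series by `τ`. -/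
theorem subst_extendLast_rename (τ : Fin 2 → MvPowerSeries (Fin 2) k) (hτ : ∀ i, constantCoeff (τ i) = 0) (G : MvPowerSeries (Fin 2) k) :
    subst (extendLast τ) (rename (Fin.succAboveEmb (Fin.last 2)) G) = rename (Fin.succAboveEmb (Fin.last 2)) (subst τ G) := by
  have hS : HasSubst (extendLast τ) := hasSubst_of_constantCoeff_zero (constantCoeff_extendLast' τ hτ)
  have hτs : HasSubst τ := hasSubst_of_constantCoeff_zero hτ
  rw [rename_eq_subst, subst_comp_subst_apply (HasSubst.X_comp _) hS, rename_eq_subst, subst_comp_subst_apply hτs (HasSubst.X_comp _)]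
  congr 1
  funext i
  rw [Function.comp_apply, subst_X hS, ← rename_eq_subst]
  show extendLast τ (Fin.succAbove (Fin.last 2) i) = _
  rw [Fin.succAbove_last]
  exact extendLast_castSucc τ i

/-- **THE PRIME OF A `u₂`-GRAPH DATUM.**  Let `(g, ψ)` be a u₁-graph datum of the swapped label `j ↦ A_j(u₂,u₁)` (`g` `u₂`-free, `ψ(0) = 0`).
Then there is a prime `P` of `k⟦u₁,u₂,y⟧` with `P ≠ 𝔪`, `monicGerm d A ∈ P^d`, `u₁ − u₂·ĝ ∈ P` where `ĝ = g(u₂,u₁)` renamed, `u₂ ∉ P`, and every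
`u₂`-free plane series `G` with `Ĝ ∈ P` vanishes. -/
theorem exists_prime_of_swapGraphDatum {d : ℕ} (A : Fin d → MvPowerSeries (Fin 2) k) {g ψ : MvPowerSeries (Fin 2) k}
    (hg : ∀ e : Fin 2 →₀ ℕ, e 1 ≠ 0 → coeff e g = 0) (hψ : constantCoeff ψ = 0)
    (hperm : IsPermissibleTwoT d (shift d (shearT g (fun j => subst (![X 1, X 0] : Fin 2 → MvPowerSeries (Fin 2) k) (A j))) ψ)) :
    ∃ P : Ideal (MvPowerSeries (Fin 3) k), P.IsPrime ∧ P ≠ IsLocalRing.maximalIdeal (MvPowerSeries (Fin 3) k) ∧ monicGerm d A ∈ P ^ d ∧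
      (X 0 - X 1 * rename (Fin.succAboveEmb (Fin.last 2)) (subst (![X 1, X 0] : Fin 2 → MvPowerSeries (Fin 2) k) g) ∈ P) ∧ (X 1 ∉ P) ∧
      (∀ G : MvPowerSeries (Fin 2) k, (∀ e : Fin 2 →₀ ℕ, e 1 ≠ 0 → coeff e G = 0) →
        rename (Fin.succAboveEmb (Fin.last 2)) (subst (![X 1, X 0] : Fin 2 → MvPowerSeries (Fin 2) k) G) ∈ P → G = 0) := by
  obtain ⟨Q, hQ, -, hgerm, hsub, hX0, hfix⟩ := exists_prime_of_graphDatum _ hg hψ hperm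
  -- the swap automorphism `S` of `k⟦u₁,u₂,y⟧` and its inverse
  have h0 : ∀ i, constantCoeff (extendLast (![X 1, X 0] : Fin 2 → MvPowerSeries (Fin 2) k) i) = 0 :=
    constantCoeff_extendLast' _ TOT2Curve.constantCoeff_swapFamily
  have hS : HasSubst (extendLast (![X 1, X 0] : Fin 2 → MvPowerSeries (Fin 2) k)) := hasSubst_of_constantCoeff_zero h0
  obtain ⟨τ, hτσ, hστ⟩ := exists_inverse_ringHom h0 (by rw [det_linMat_extendLast]; exact isUnit_det_linMat_swap)
  set S : MvPowerSeries (Fin 3) k →+* MvPowerSeries (Fin 3) k := (substAlgHom hS).toRingHom with hSdef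
  have hSapp : ∀ F, S F = subst (extendLast (![X 1, X 0] : Fin 2 → MvPowerSeries (Fin 2) k)) F := fun F => by
    rw [hSdef]; change (substAlgHom hS) F = _; rw [coe_substAlgHom]
  have hSX0 : S (X 0) = X 1 := by
    rw [hSapp, subst_X hS, show (0 : Fin 3) = Fin.castSucc (0 : Fin 2) from rfl, extendLast_castSucc, show (![X 1, X 0] : Fin 2 → MvPowerSeries (Fin 2) k) 0 = X 1 from rfl, rename_X]
    rfl
  have hSX1 : S (X 1) = X 0 := by
    rw [hSapp, subst_X hS, show (1 : Fin 3) = Fin.castSucc (1 : Fin 2) from rfl, extendLast_castSucc, show (![X 1, X 0] : Fin 2 → MvPowerSeries (Fin 2) k) 1 = X 0 from rfl, rename_X]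
    rfl
  have hSren : ∀ G : MvPowerSeries (Fin 2) k, S (rename (Fin.succAboveEmb (Fin.last 2)) G) =
      rename (Fin.succAboveEmb (Fin.last 2)) (subst (![X 1, X 0] : Fin 2 → MvPowerSeries (Fin 2) k) G) := fun G => by
    rw [hSapp, subst_extendLast_rename _ TOT2Curve.constantCoeff_swapFamily]
  refine ⟨Q.comap S, Ideal.IsPrime.comap S, ?_, ?_, ?_, ?_, ?_⟩
  · -- `P ≠ 𝔪`: `u₂ ∈ 𝔪 \ P`
    intro hP
    have h1 : (X 1 : MvPowerSeries (Fin 3) k) ∈ Q.comap S := by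
      rw [hP, IsLocalRing.mem_maximalIdeal, mem_nonunits_iff, MvPowerSeries.isUnit_iff_constantCoeff, constantCoeff_X]
      exact not_isUnit_zero
    rw [Ideal.mem_comap, hSX1] at h1
    exact hX0 h1
  · -- `monicGerm d A ∈ P^d`
    refine mem_pow_of_inverse S τ (fun x => by rw [hSapp]; exact hτσ x) (Q := Q) (fun q hq => ?_) ?_
    · rw [Ideal.mem_comap, hSapp, hστ]
      exact hq
    · rw [hSapp, subst_extendLast_swap_monicGerm]
      exact hgerm
  · -- `u₁ − u₂ ĝ ∈ P`
    rw [Ideal.mem_comap, map_sub, map_mul, hSX0, hSX1, hSren, TOT2Curve.subst_swap_subst_swap]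
    exact hsub
  · -- `u₂ ∉ P`
    rw [Ideal.mem_comap, hSX1]
    exact hX0
  · -- `u₂`-free plane series, swapped and renamed, meet `P` trivially
    intro G hG hGP
    rw [Ideal.mem_comap, hSren, TOT2Curve.subst_swap_subst_swap] at hGP
    exact hfix G hG hGP

/-- **THE `u₂`-READING IS INJECTIVE.** -/
theorem eq_of_sub_mem_of_sub_mem_swap {P : Ideal (MvPowerSeries (Fin 3) k)} (hP : P.IsPrime) (hX1 : (X 1 : MvPowerSeries (Fin 3) k) ∉ P)
    (hfix : ∀ G : MvPowerSeries (Fin 2) k, (∀ e : Fin 2 →₀ ℕ, e 1 ≠ 0 → coeff e G = 0) →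
      rename (Fin.succAboveEmb (Fin.last 2)) (subst (![X 1, X 0] : Fin 2 → MvPowerSeries (Fin 2) k) G) ∈ P → G = 0)
    {g g' : MvPowerSeries (Fin 2) k} (hg : ∀ e : Fin 2 →₀ ℕ, e 1 ≠ 0 → coeff e g = 0) (hg' : ∀ e : Fin 2 →₀ ℕ, e 1 ≠ 0 → coeff e g' = 0)
    (h1 : X 0 - X 1 * rename (Fin.succAboveEmb (Fin.last 2)) (subst (![X 1, X 0] : Fin 2 → MvPowerSeries (Fin 2) k) g) ∈ P)
    (h2 : X 0 - X 1 * rename (Fin.succAboveEmb (Fin.last 2)) (subst (![X 1, X 0] : Fin 2 → MvPowerSeries (Fin 2) k) g') ∈ P) :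
    g = g' := by
  have hsw : HasSubst (![X 1, X 0] : Fin 2 → MvPowerSeries (Fin 2) k) := TOT2Curve.hasSubst_swap
  have h3 : (X 1 : MvPowerSeries (Fin 3) k) *
      rename (Fin.succAboveEmb (Fin.last 2)) (subst (![X 1, X 0] : Fin 2 → MvPowerSeries (Fin 2) k) (g' - g)) ∈ P := by
    have h4 := Ideal.sub_mem P h1 h2
    rw [← coe_substAlgHom hsw, map_sub, coe_substAlgHom, map_sub]
    have h5 : (X 0 - X 1 * rename (Fin.succAboveEmb (Fin.last 2)) (subst (![X 1, X 0] : Fin 2 → MvPowerSeries (Fin 2) k) g)) -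
        (X 0 - X 1 * rename (Fin.succAboveEmb (Fin.last 2)) (subst (![X 1, X 0] : Fin 2 → MvPowerSeries (Fin 2) k) g')) =
        (X 1 : MvPowerSeries (Fin 3) k) * (rename (Fin.succAboveEmb (Fin.last 2)) (subst (![X 1, X 0] : Fin 2 → MvPowerSeries (Fin 2) k) g') -
          rename (Fin.succAboveEmb (Fin.last 2)) (subst (![X 1, X 0] : Fin 2 → MvPowerSeries (Fin 2) k) g)) := by ring
    rwa [h5] at h4
  rcases hP.mem_or_mem h3 with h4 | h4
  · exact absurd h4 hX1
  · have h5 := hfix (g' - g) (fun e he => by rw [map_sub, hg e he, hg' e he, sub_zero]) h4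
    exact (sub_eq_zero.mp h5).symm

/-- **DISJOINTNESS OF THE TWO READINGS.**  A prime containing `u₂ − u₁h̃` (read from a u₁-graph datum `h`) and a prime containing
`u₁ − u₂ĝ` with `ĝ(0) = 0` (read from a TANGENT u₂-graph datum) and not containing `u₂` are different. -/
theorem ne_of_readings {P₁ P₂ : Ideal (MvPowerSeries (Fin 3) k)} {H G : MvPowerSeries (Fin 3) k} (hG0 : constantCoeff G = 0)
    (h1 : X 1 - X 0 * H ∈ P₁) (h2 : X 0 - X 1 * G ∈ P₂) (hX1 : (X 1 : MvPowerSeries (Fin 3) k) ∉ P₂) : P₁ ≠ P₂ := by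
  rintro rfl
  -- `u₂ (1 − H G) = (u₂ − u₁H) + H (u₁ − u₂ G) ∈ P`
  have h3 : (X 1 : MvPowerSeries (Fin 3) k) * (1 - H * G) ∈ P₁ := by
    have h4 : (X 1 : MvPowerSeries (Fin 3) k) * (1 - H * G) = (X 1 - X 0 * H) + H * (X 0 - X 1 * G) := by ring
    rw [h4]
    exact Ideal.add_mem _ h1 (Ideal.mul_mem_left _ _ h2)
  have hu : IsUnit (1 - H * G : MvPowerSeries (Fin 3) k) := by
    rw [MvPowerSeries.isUnit_iff_constantCoeff, map_sub, map_one, map_mul, hG0, mul_zero, sub_zero]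
    exact isUnit_one
  exact hX1 ((Ideal.unit_mul_mem_iff_mem P₁ hu).mp (by rwa [mul_comm] at h3))

/-- The tangent `u₂`-graph data (`g(0) = 0`) have renamed swapped data with zero constant term. -/
theorem constantCoeff_rename_subst_swap {g : MvPowerSeries (Fin 2) k} (hg0 : constantCoeff g = 0) :
    constantCoeff (rename (Fin.succAboveEmb (Fin.last 2)) (subst (![X 1, X 0] : Fin 2 → MvPowerSeries (Fin 2) k) g) :
      MvPowerSeries (Fin 3) k) = 0 := by
  rw [constantCoeff_rename, TOT2Curve.constantCoeff_subst_swap, hg0]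

end NCBranchPrimes

end Summit.ResolutionOfSingularities.ResolutionOfSingularities.Theorems

end
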